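import Mathlib
import Summits.Ventures.PercRepro2.BoxUnionDefs
import Summits.Ventures.PercRepro2.BoxUnionFKG

/-!
# The box-union covariance inequality for log-supermodular weights
(blind cell PercRepro2, mine-1 g36; paper proof proofs/MINE1-BOXUNION.md; part 3 of 3)
Let `α` be a finite distributive lattice, `ν : α → ℝ` a nonnegative **log-supermodular** weight
(`ν x * ν y ≤ ν (x ⊓ y) * ν (x ⊔ y)`) with positive total mass, `f g : α → ℝ` monotone, `a b : α`
arbitrary and `U = ↓a ∪ ↑b = {x | x ≤ a ∨ b ≤ x}`.  Then the covariance of `f` and `g`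
*restricted to `U`* is nonnegative:

  `∑_{x ∈ U} ν x * (f x - E f) * (g x - E g) ≥ 0`,   `E f = (∑ ν f) / (∑ ν)`   (`boxUnion_nonneg`).

For `U = α` this is the FKG inequality; for a single box `↓a` (or `↑b`) it follows from FKG on
the sublattice and the sign of the "tension" `(E_{↓a} f - E f)(E_{↓a} g - E g) ≥ 0`; for the union
the tension can be negative and the statement is NOT a consequence of positive association of
`ν` and of its conditionings (exact counterexamples, proofs/MINE1-UNION-TENSION.md §5).

**Proof** (three FKG / Holley / Ahlswede–Daykin steps, all through Mathlib's
`four_functions_theorem_univ`).  The map `ρ x = (x ⊓ b, x ⊔ a)` is a lattice homomorphism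
`α → α × α`; `x ≤ a ↔ ρ x ≤ ρ a` and `b ≤ x ↔ ρ b ≤ ρ x`, so `↓a`, `↑b` and `U` are unions of
its fibres, and when `b ≤ a` the interval `[b, a]` is the single fibre of `ρ a = ρ b = (b, a)`.
Writing `F x = E[f ∣ fibre of x]` (the fibre mean, `0` on a massless fibre) and `G` likewise,
the law of total covariance on the fibres gives
`Φ_U(f, g) = ∑_{fibres ⊆ U} (fibre covariance) + Φ_U(F, G)`; each fibre covariance is `≥ 0` by
FKG on the fibre (a sublattice), and `Φ_U(F, G) ≥ 0` is the collapsed problem: `F`, `G` are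
monotone on the support of `ν` (Holley across fibres), and `Φ_U(F,G) = Φ_{↓a} + Φ_{↑b} - Φ_{[b,a]}`
with `F`, `G` constant on `[b, a]`, which is settled by a three-way case split on the signs of
`F a - E f` and `G a - E g` (if both `≥ 0`, every `x ≥ b` has `F x ≥ F a ≥ E f`, so
`Φ_{↑b} - Φ_{[b,a]} ≥ 0` termwise; if both `≤ 0`, dually with `↓a`; otherwise `Φ_{[b,a]} ≤ 0`).
Nonnegativity of `f`, `g` is assumed for the four-functions steps and removed at the end by a
shift (`boxUnion_nonneg`).
-/

namespace Summit.Ventures.PercRepro2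

namespace BoxUnion

open Finset

open scoped Classical

noncomputable section

section Sums

variable {α : Type*} [DistribLattice α] [Fintype α]

variable {ν f : α → ℝ} {a b : α}

section General

/-! ### The theorem -/

/-- The fibre `k` lies in `U = ↓a ∪ ↑b` iff `k ≤ ρ a ∨ ρ b ≤ k`. -/
lemma union_iff_of_mem_fib {k : α × α} {x : α} (hx : x ∈ fib a b k) :
    x ∈ boxUnion a b ↔ (k ≤ rho a b a ∨ rho a b b ≤ k) := by
  rw [mem_boxUnion, ← rho_le_rho_a_iff a b x, ← rho_b_le_rho_iff a b x, mem_fib.mp hx]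

/-- Expanding a fibre covariance. -/
lemma sum_fib_expand (k : α × α) (g : α → ℝ) (m m' : ℝ) :
    (∑ x ∈ fib a b k, ν x * ((f x - m) * (g x - m')))
      = (∑ x ∈ fib a b k, ν x * (f x * g x)) - m * S ν g a b k - m' * S ν f a b k
        + m * m' * M ν a b k := by
  simp only [S, M, mul_sum, ← sum_sub_distrib, ← sum_add_distrib]
  refine sum_congr rfl fun x _ => ?_
  ring

/-- The fibre covariance `∑_{fib k} ν f g - fmean f k * S g k` is nonnegative (FKG on the
fibre, a sublattice). -/
lemma fibre_cov_nonneg (hν : ∀ x, 0 ≤ ν x) (hlsm : ∀ x y, ν x * ν y ≤ ν (x ⊓ y) * ν (x ⊔ y))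
    (hf : Monotone f) (hf0 : ∀ x, 0 ≤ f x) {g : α → ℝ} (hg : Monotone g) (hg0 : ∀ x, 0 ≤ g x)
    (k : α × α) :
    0 ≤ (∑ x ∈ fib a b k, ν x * (f x * g x)) - fmean ν f a b k * S ν g a b k := by
  have hfkg := fkg_on hν hlsm hf0 hg0 (fun x y _ _ => hf le_sup_left)
    (fun x y _ _ => hg le_sup_left) (fun x => rho a b x = k)
    (fun x y hx hy => ⟨by rw [rho_inf, hx, hy, inf_idem], by rw [rho_sup, hx, hy, sup_idem]⟩)
  have hfkg' : S ν f a b k * S ν g a b k ≤ M ν a b k * ∑ x ∈ fib a b k, ν x * (f x * g x) := by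
    rw [S_eq, S_eq, M_eq, fib, sum_filter]
    exact hfkg
  by_cases hM : M ν a b k = 0
  · rw [fmean, hM, div_zero, zero_mul, sub_zero]
    exact sum_nonneg fun x _ => mul_nonneg (hν x) (mul_nonneg (hf0 x) (hg0 x))
  · have hMpos : 0 < M ν a b k := lt_of_le_of_ne (M_nonneg hν k) (Ne.symm hM)
    rw [sub_nonneg, fmean, div_mul_eq_mul_div, div_le_iff₀ hMpos]
    linarith [hfkg']

/-- **Step A — the fibrewise decomposition.** The restricted covariance of `f, g` on `U` equals
the sum of the fibre covariances over the fibres in `U` plus the restricted covariance of the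
fibre-mean functions `F, G` on `U` (the cross terms vanish because `F, G` are constant on the
fibres). -/
lemma phiOn_union_decomp (hν : ∀ x, 0 ≤ ν x) {g : α → ℝ} (m m' : ℝ) :
    phiOn ν f g m m' (fun x => x ∈ boxUnion a b)
      = (∑ k, if (k ≤ rho a b a ∨ rho a b b ≤ k) then
            (∑ x ∈ fib a b k, ν x * (f x * g x)) - fmean ν f a b k * S ν g a b k else 0)
        + phiOn ν (F ν f a b) (F ν g a b) m m' (fun x => x ∈ boxUnion a b) := by
  simp only [phiOn]
  rw [sum_fib (a := a) (b := b) (fun x => if x ∈ boxUnion a b then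
    ν x * ((f x - m) * (g x - m')) else 0),
    sum_fib (a := a) (b := b) (fun x => if x ∈ boxUnion a b then
    ν x * ((F ν f a b x - m) * (F ν g a b x - m')) else 0), ← sum_add_distrib]
  refine sum_congr rfl fun k _ => ?_
  -- on the fibre `k`, the indicator of `U` and the fibre means are constant
  have hU : ∀ x ∈ fib a b k, (if x ∈ boxUnion a b then ν x * ((f x - m) * (g x - m')) else 0)
      = if (k ≤ rho a b a ∨ rho a b b ≤ k) then ν x * ((f x - m) * (g x - m')) else 0 := by
    intro x hx
    simp only [union_iff_of_mem_fib hx]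
  have hU' : ∀ x ∈ fib a b k,
      (if x ∈ boxUnion a b then ν x * ((F ν f a b x - m) * (F ν g a b x - m')) else 0)
      = if (k ≤ rho a b a ∨ rho a b b ≤ k) then
          ν x * ((fmean ν f a b k - m) * (fmean ν g a b k - m')) else 0 := by
    intro x hx
    simp only [union_iff_of_mem_fib hx, F, mem_fib.mp hx]
  rw [sum_congr rfl hU, sum_congr rfl hU']
  by_cases hk : (k ≤ rho a b a ∨ rho a b b ≤ k)
  · simp only [hk, if_true]
    rw [sum_fib_expand, ← sum_mul]
    have hc := fmean_mul_M hν (f := f) (a := a) (b := b) k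
    have hd := fmean_mul_M hν (f := g) (a := a) (b := b) k
    have hM : (∑ x ∈ fib a b k, ν x) = M ν a b k := rfl
    linear_combination m' * hc + (m - fmean ν f a b k) * hd
      - (fmean ν f a b k - m) * (fmean ν g a b k - m') * hM
  · simp only [hk, if_false, sum_const_zero, add_zero]

/-- The mean of the fibre-mean function equals the mean of `f`. -/
lemma mean_F (hν : ∀ x, 0 ≤ ν x) : mean ν (F ν f a b) = mean ν f := by
  unfold mean
  rw [sum_nu_F hν]

/-- The interval `[b, a]` carries mass `M (ρ a)` when `b ≤ a`. -/
lemma sum_interval_eq_M (hba : b ≤ a) :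
    (∑ x, if (b ≤ x ∧ x ≤ a) then ν x else 0) = M ν a b (rho a b a) := by
  rw [M_eq]
  refine sum_congr rfl fun x _ => ?_
  simp only [rho_eq_rho_a_iff hba x]

/-- On the interval `[b, a]` the fibre-mean function is constant (`= F a`). -/
lemma F_eq_F_a (hba : b ≤ a) {x : α} (hx : b ≤ x ∧ x ≤ a) : F ν f a b x = F ν f a b a := by
  unfold F
  rw [(rho_eq_rho_a_iff hba x).mpr hx]

/-- **Step B — the collapsed problem.** The restricted covariance of the fibre-mean functions
`F, G` on `U = ↓a ∪ ↑b` (centred at the means of `f, g`) is nonnegative: `F, G` are constant on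
the interval `[b, a]`, so `Φ_U = Φ_{↓a} + Φ_{↑b} - Φ_{[b,a]}` is settled by the single-box lemmas
and a case split on the signs of `F a - E f`, `G a - E g`. -/
lemma phiOn_union_F_nonneg (hν : ∀ x, 0 ≤ ν x)
    (hlsm : ∀ x y, ν x * ν y ≤ ν (x ⊓ y) * ν (x ⊔ y)) (hZ : 0 < ∑ x, ν x)
    (hf : Monotone f) (hf0 : ∀ x, 0 ≤ f x) {g : α → ℝ} (hg : Monotone g) (hg0 : ∀ x, 0 ≤ g x) :
    0 ≤ phiOn ν (F ν f a b) (F ν g a b) (mean ν f) (mean ν g) (fun x => x ∈ boxUnion a b) := by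
  set m := mean ν f with hm
  set m' := mean ν g with hm'
  have hF0 := F_nonneg (a := a) (b := b) hν hf0
  have hG0 := F_nonneg (a := a) (b := b) hν hg0
  have hF := F_le_F_sup (a := a) (b := b) hν hlsm hf hf0
  have hG := F_le_F_sup (a := a) (b := b) hν hlsm hg hg0
  -- the two single-box lemmas
  have hA : 0 ≤ phiOn ν (F ν f a b) (F ν g a b) m m' (fun x => x ≤ a) := by
    have := phiOn_nonneg_down hν hlsm hZ hF0 hG0 hF hG (fun x => x ≤ a)
      (fun x y hx hy => ⟨inf_le_left.trans hx, sup_le hx hy⟩)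
      (fun x y hx => inf_le_left.trans hx)
    rwa [mean_F hν, mean_F hν] at this
  have hB : 0 ≤ phiOn ν (F ν f a b) (F ν g a b) m m' (fun x => b ≤ x) := by
    have := phiOn_nonneg_up hν hlsm hZ hF0 hG0 hF hG (fun x => b ≤ x)
      (fun x y hx hy => ⟨le_inf hx hy, hx.trans le_sup_left⟩)
      (fun x y hx => hx.trans le_sup_left)
    rwa [mean_F hν, mean_F hν] at this
  -- inclusion–exclusion
  have hIE : phiOn ν (F ν f a b) (F ν g a b) m m' (fun x => x ∈ boxUnion a b)
      = phiOn ν (F ν f a b) (F ν g a b) m m' (fun x => x ≤ a)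
        + phiOn ν (F ν f a b) (F ν g a b) m m' (fun x => b ≤ x)
        - phiOn ν (F ν f a b) (F ν g a b) m m' (fun x => b ≤ x ∧ x ≤ a) := by
    simp only [phiOn]
    rw [← sum_add_distrib, ← sum_sub_distrib]
    refine sum_congr rfl fun x _ => ?_
    by_cases h1 : x ≤ a <;> by_cases h2 : b ≤ x <;> simp [mem_boxUnion, h1, h2]
  rw [hIE]
  by_cases hba : b ≤ a
  · -- the interval term is `(F a - m) (G a - m') * M (ρ a)`
    have hI : phiOn ν (F ν f a b) (F ν g a b) m m' (fun x => b ≤ x ∧ x ≤ a)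
        = ((F ν f a b a - m) * (F ν g a b a - m')) * M ν a b (rho a b a) := by
      simp only [phiOn]
      rw [← sum_interval_eq_M hba, mul_sum]
      refine sum_congr rfl fun x _ => ?_
      by_cases hx : (b ≤ x ∧ x ≤ a)
      · rw [if_pos hx, if_pos hx, F_eq_F_a hba hx, F_eq_F_a hba hx]
        ring
      · rw [if_neg hx, if_neg hx, mul_zero]
    rw [hI]
    have hMI : 0 ≤ M ν a b (rho a b a) := M_nonneg hν _
    rcases hMI.lt_or_eq with hMpos | hM0
    · by_cases h1 : m ≤ F ν f a b a
      · by_cases h2 : m' ≤ F ν g a b a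
        · -- both tensions nonnegative: the up-box dominates the interval
          have hBI : 0 ≤ phiOn ν (F ν f a b) (F ν g a b) m m' (fun x => b ≤ x)
              - ((F ν f a b a - m) * (F ν g a b a - m')) * M ν a b (rho a b a) := by
            rw [← hI]
            simp only [phiOn]
            rw [← sum_sub_distrib]
            refine sum_nonneg fun x _ => ?_
            by_cases hx : b ≤ x
            · by_cases hxa : x ≤ a
              · rw [if_pos hx, if_pos ⟨hx, hxa⟩, sub_self]
              · rw [if_pos hx, if_neg (fun h => hxa h.2), sub_zero]
                rcases (hν x).lt_or_eq with hνx | hνx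
                · have hk : rho a b a ≤ rho a b x := rho_a_le_rho_of_b_le hba hx
                  have hMx : 0 < M ν a b (rho a b x) := lt_of_lt_of_le hνx (nu_le_M hν x)
                  have hFx : F ν f a b a ≤ F ν f a b x :=
                    fmean_le_fmean hν hlsm hf hf0 hk hMpos hMx
                  have hGx : F ν g a b a ≤ F ν g a b x :=
                    fmean_le_fmean hν hlsm hg hg0 hk hMpos hMx
                  exact mul_nonneg (hν x) (mul_nonneg (by linarith) (by linarith))
                · rw [← hνx, zero_mul]
            · rw [if_neg hx, if_neg (fun h => hx h.1), sub_zero]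
          linarith
        · -- mixed signs: the interval term is nonpositive
          have h2' : F ν g a b a < m' := not_le.mp h2
          have : ((F ν f a b a - m) * (F ν g a b a - m')) * M ν a b (rho a b a) ≤ 0 :=
            mul_nonpos_of_nonpos_of_nonneg
              (mul_nonpos_iff.mpr (Or.inl ⟨by linarith, by linarith⟩)) hMI
          linarith
      · have h1' : F ν f a b a < m := not_le.mp h1
        by_cases h2 : m' ≤ F ν g a b a
        · -- mixed signs
          have : ((F ν f a b a - m) * (F ν g a b a - m')) * M ν a b (rho a b a) ≤ 0 :=
            mul_nonpos_of_nonpos_of_nonneg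
              (mul_nonpos_iff.mpr (Or.inr ⟨by linarith, by linarith⟩)) hMI
          linarith
        · -- both tensions nonpositive: the down-box dominates the interval
          have h2' : F ν g a b a < m' := not_le.mp h2
          have hAI : 0 ≤ phiOn ν (F ν f a b) (F ν g a b) m m' (fun x => x ≤ a)
              - ((F ν f a b a - m) * (F ν g a b a - m')) * M ν a b (rho a b a) := by
            rw [← hI]
            simp only [phiOn]
            rw [← sum_sub_distrib]
            refine sum_nonneg fun x _ => ?_
            by_cases hxa : x ≤ a
            · by_cases hx : b ≤ x
              · rw [if_pos hxa, if_pos ⟨hx, hxa⟩, sub_self]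
              · rw [if_pos hxa, if_neg (fun h => hx h.1), sub_zero]
                rcases (hν x).lt_or_eq with hνx | hνx
                · have hk : rho a b x ≤ rho a b a := rho_le_rho_a_of_le hxa
                  have hMx : 0 < M ν a b (rho a b x) := lt_of_lt_of_le hνx (nu_le_M hν x)
                  have hFx : F ν f a b x ≤ F ν f a b a :=
                    fmean_le_fmean hν hlsm hf hf0 hk hMx hMpos
                  have hGx : F ν g a b x ≤ F ν g a b a :=
                    fmean_le_fmean hν hlsm hg hg0 hk hMx hMpos
                  exact mul_nonneg (hν x)
                    (mul_nonneg_of_nonpos_of_nonpos (by linarith) (by linarith))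
                · rw [← hνx, zero_mul]
            · rw [if_neg hxa, if_neg (fun h => hxa h.2), sub_zero]
          linarith
    · rw [← hM0, mul_zero, sub_zero]
      exact add_nonneg hA hB
  · -- `b ≰ a`: the interval is empty
    have hI : phiOn ν (F ν f a b) (F ν g a b) m m' (fun x => b ≤ x ∧ x ≤ a) = 0 := by
      simp only [phiOn]
      exact sum_eq_zero fun x _ => if_neg (fun h => hba (h.1.trans h.2))
    rw [hI, sub_zero]
    exact add_nonneg hA hB

/-- **The box-union covariance inequality** for nonnegative monotone `f g`. -/
theorem boxUnion_nonneg_of_nonneg (hν : ∀ x, 0 ≤ ν x)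
    (hlsm : ∀ x y, ν x * ν y ≤ ν (x ⊓ y) * ν (x ⊔ y)) (hZ : 0 < ∑ x, ν x)
    (hf : Monotone f) (hf0 : ∀ x, 0 ≤ f x) {g : α → ℝ} (hg : Monotone g) (hg0 : ∀ x, 0 ≤ g x) :
    0 ≤ phiOn ν f g (mean ν f) (mean ν g) (fun x => x ∈ boxUnion a b) := by
  rw [phiOn_union_decomp (a := a) (b := b) hν]
  refine add_nonneg (sum_nonneg fun k _ => ?_) (phiOn_union_F_nonneg hν hlsm hZ hf hf0 hg hg0)
  split_ifs
  · exact fibre_cov_nonneg hν hlsm hf hf0 hg hg0 k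
  · exact le_rfl

omit [DistribLattice α] in
/-- Shifting `f` and `g` by constants does not change the restricted covariance. -/
lemma phiOn_shift (hZ : 0 < ∑ x, ν x) (g : α → ℝ) (c d : ℝ) (P : α → Prop)
    [DecidablePred P] :
    phiOn ν (fun x => f x + c) (fun x => g x + d) (mean ν (fun x => f x + c))
        (mean ν (fun x => g x + d)) P
      = phiOn ν f g (mean ν f) (mean ν g) P := by
  have hmf : mean ν (fun x => f x + c) = mean ν f + c := by
    simp only [mean]
    rw [div_eq_iff hZ.ne', add_mul, div_mul_cancel₀ _ hZ.ne', mul_sum, ← sum_add_distrib]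
    exact sum_congr rfl fun x _ => by ring
  have hmg : mean ν (fun x => g x + d) = mean ν g + d := by
    simp only [mean]
    rw [div_eq_iff hZ.ne', add_mul, div_mul_cancel₀ _ hZ.ne', mul_sum, ← sum_add_distrib]
    exact sum_congr rfl fun x _ => by ring
  simp only [phiOn]
  rw [hmf, hmg]
  refine sum_congr rfl fun x _ => ?_
  split_ifs
  · ring
  · rfl

/-- **The box-union covariance inequality** (BOX-UNION). Let `ν` be a nonnegative
log-supermodular weight of positive total mass on a finite distributive lattice, `f g` monotone,
`a b` arbitrary and `U = ↓a ∪ ↑b`. Then `∑_{x ∈ U} ν x (f x - E f)(g x - E g) ≥ 0`, where `E` is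
the `ν`-mean `mean ν`. -/
theorem boxUnion_nonneg (hν : ∀ x, 0 ≤ ν x)
    (hlsm : ∀ x y, ν x * ν y ≤ ν (x ⊓ y) * ν (x ⊔ y)) (hZ : 0 < ∑ x, ν x)
    (hf : Monotone f) {g : α → ℝ} (hg : Monotone g) :
    0 ≤ ∑ x, if x ∈ boxUnion a b then
      ν x * ((f x - mean ν f) * (g x - mean ν g)) else 0 := by
  have key := boxUnion_nonneg_of_nonneg (a := a) (b := b) hν hlsm hZ
    (f := fun x => f x + ∑ y, |f y|) (hf.add_const _)
    (fun x => by
      have h1 : |f x| ≤ ∑ y, |f y| := single_le_sum (fun y _ => abs_nonneg (f y)) (mem_univ x)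
      linarith [neg_abs_le (f x)])
    (g := fun x => g x + ∑ y, |g y|) (hg.add_const _)
    (fun x => by
      have h1 : |g x| ≤ ∑ y, |g y| := single_le_sum (fun y _ => abs_nonneg (g y)) (mem_univ x)
      linarith [neg_abs_le (g x)])
  rw [phiOn_shift hZ] at key
  exact key

end General

end Sums

end

end BoxUnion

end Summit.Ventures.PercRepro2
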